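import Literature.NumberTheory.DiophantineGeometry.AbcDepthCensusChunked

/-!
# A certified census of abc triples by 5-depth in boxes `c ≤ N` — the turbo checker

Fifth layer over `AbcDepthCensus.lean` / `…CRT.lean` / `…Fast.lean` / `…Chunked.lean`, with the same
soundness statement and the same chunk / cover vocabulary (`followPrefix`, `coversAll`), and three
efficiency changes found by measuring where the compiled evaluations of the chunked checker spend their
time on the deep cells (`ω₅ ≥ 9` in `10¹⁸`: `1.96·10⁷` patterns but `3.1·10⁸` visited tree nodes and one
Chinese-remainder unit per pattern):

* **the min-member cut.**  At a node of the pattern tree (next prime `p`, `k + 1` primes still to be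
  placed, part products `A, B, C`), if `N < min(A,B,C)·p⁵` then no later prime (all `≥ p`, the list is
  ascending) fits into any member, so the sub-tree holds no pattern (`patterns_succ_eq_nil`); the walk
  returns at once instead of skipping through the rest of the prime list.  On the deep cells this removes
  `85–95 %` of the visited nodes (`3.1·10⁸ → 4.1·10⁷` for `ω₅ ≥ 9` in `10¹⁸`; the patterns are unchanged);
* **a fused walk with a threshold table.**  `turboTree` carries `M = A·B·C` and compares it with the
  precomputed `⌊N³ / (4·p^{5(k+1)})⌋` (`turboTable`; `Nat.div_lt_iff_lt_mul`) instead of forming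
  `4·A·B·C·p^{5(k+1)}` at every node, and runs the per-pattern walk at the leaves (no pattern list);
  `turboFollow` replays a chunk prefix exactly like `followPrefix` (`turboFollow_sound`);
* **a cheap per-pattern walk.**  `loopTurbo` dispatches on the lattice density: when
  `(N / M_max)·(N / M_mid) ≤ 24` the plain double iteration `loopBest` (no modular inverse) is used,
  otherwise `loopCRTv` — the hoisted-unit Chinese-remainder walk of `loopCRTe` with the unit computed by a
  small extended-Euclid loop in 64-bit machine arithmetic (`unitCand`) and VALIDATED at run time
  (`M₁·u % M₂ = 1 % M₂`, which also certifies coprimality — `coprime_of_unit_check`; otherwise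
  `loopBest`), so that no correctness proof of the inverse routine and no `gcd` is needed
  (`Nat.chineseRemainder` costs ≈ 35 µs per pattern in compiled code, the double iteration ≈ 0.2 µs per
  candidate).

Soundness (`checkTurboChunks_sound`, `depth_lt_of_checkTurboChunks`, `depth_lt_of_checkTurboChunks_gcd`,
`hits_complete_of_checkTurboChunks`) is reduced to the previous layers: `loopBest_sound`,
`allPosRes_spec`, `mod_mul_eq_unit_mul`, `mem_patterns` via `sound_of_forall_patterns`, and the cover
lemma `exists_mem_followPrefix_of_coversAll`.  No axiom beyond `propext`, `Classical.choice`,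
`Quot.sound`; compiled evaluations live with the consumers
(`Summits/ABC/ABC/Theorems/IneffectiveSubspaceDeepRegimeABCCensus*.lean`).  Measured (farm, cell `ω₅ ≥ 9`,
box `10¹⁷`, no candidate): `checkCellFast` 141 s, turbo walk with `loopCRTe` 88 s, with the checked unit
55 s; the dispatch removes most of the remaining unit computations.  Source of the algorithm: this project
(standard pruning / work-splitting of a depth-first enumeration); the facts certified are finite
computations.
-/

namespace Literature.NumberTheory.DiophantineGeometry.DepthCensus

/-! ## A run-time-checked Chinese-remainder unit -/

/-- Extended Euclid in 64-bit machine arithmetic with SIGNED Bézout coefficients in sign-magnitude form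
(`t₀, t₁` magnitudes, `s₀, s₁` signs): state `(r₀, r₁, t₀, s₀, t₁, s₁)`; returns `t₀ mod m` when `r₁ = 0`
(or the fuel is exhausted).  For `m < 2⁶³` no step wraps (`|tᵢ| ≤ m`, `q·|t₁| ≤ 2m`); in any case the
output is only ever used after a run-time check, so nothing is proved about it. [folklore] -/
def invLoop64 (m : UInt64) : ℕ → UInt64 → UInt64 → UInt64 → Bool → UInt64 → Bool → UInt64
  | 0, _, _, t₀, s₀, _, _ => if s₀ && t₀ != 0 then m - t₀ else t₀
  | fuel + 1, r₀, r₁, t₀, s₀, t₁, s₁ =>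
      if r₁ == 0 then (if s₀ && t₀ != 0 then m - t₀ else t₀)
      else
        let q := r₀ / r₁
        let qt := q * t₁
        let same := s₀ == s₁
        let ge := decide (qt ≤ t₀)
        let nm := if same then (if ge then t₀ - qt else qt - t₀) else t₀ + qt
        let ns := if same then (if ge then s₀ else !s₀) else s₀
        invLoop64 m fuel r₁ (r₀ - q * r₁) t₁ s₁ nm ns

/-- Extended Euclid on `ℕ` (for moduli `≥ 2⁶³`), the Bézout coefficient tracked modulo `m`:
state `(r₀, r₁, t₀, t₁)`; returns `t₀` when `r₁ = 0` (or the fuel is exhausted); unchecked. [folklore] -/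
def invLoopNat (m : ℕ) : ℕ → ℕ → ℕ → ℕ → ℕ → ℕ
  | 0, _, _, t₀, _ => t₀
  | fuel + 1, r₀, r₁, t₀, t₁ =>
      if r₁ = 0 then t₀
      else
        let q := r₀ / r₁
        invLoopNat m fuel r₁ (r₀ - q * r₁) t₁ ((t₀ + m - q * t₁ % m) % m)

/-- Candidate inverse of `a` modulo `m` (unchecked): machine arithmetic below `2⁶³`, `ℕ` above.
[folklore] -/
def invMod (a m : ℕ) : ℕ :=
  if m < 9223372036854775808 then
    (invLoop64 (UInt64.ofNat m) 200 (UInt64.ofNat m) (UInt64.ofNat (a % m)) 0 false 1 false).toNat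
  else invLoopNat m 400 m (a % m) 0 1

/-- Candidate inverse of `M₁` modulo `M₂`, reduced (unchecked). [folklore] -/
def invCand (M₁ M₂ : ℕ) : ℕ := invMod M₁ M₂ % M₂

/-- Candidate unit `e = M₁·invCand` with `e ≡ 0 (mod M₁)`, `e ≡ 1 (mod M₂)` (unchecked). [folklore] -/
def unitCand (M₁ M₂ : ℕ) : ℕ := M₁ * invCand M₁ M₂

/-- A validated unit forces the two moduli to be coprime. [folklore] -/
theorem coprime_of_unit_check {e M₁ M₂ : ℕ} (h1 : e % M₁ = 0) (h2 : e % M₂ = 1 % M₂) :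
    Nat.Coprime M₁ M₂ := by
  rw [Nat.coprime_iff_gcd_eq_one]
  set d := Nat.gcd M₁ M₂ with hd
  have hd1 : d ∣ M₁ := Nat.gcd_dvd_left _ _
  have hd2 : d ∣ M₂ := Nat.gcd_dvd_right _ _
  have hde : d ∣ e := (Nat.dvd_of_mod_eq_zero h1) |> fun h => dvd_trans hd1 h
  have hmod : e ≡ 1 [MOD M₂] := h2
  have hmod' : e ≡ 1 [MOD d] := hmod.of_dvd hd2
  have h1d : 1 % d = e % d := hmod'.symm
  rw [Nat.mod_eq_zero_of_dvd hde] at h1d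
  -- `1 % d = 0` forces `d = 1`
  rcases Nat.lt_or_ge d 2 with hlt | hge
  · interval_cases d
    · -- `d = 0`: then `M₁ = M₂ = 0`, `e = 0`, and `0 % 0 = 1 % 0` is false
      have hM2 : M₂ = 0 := Nat.eq_zero_of_gcd_eq_zero_right hd.symm
      subst hM2
      have hM1 : M₁ = 0 := Nat.eq_zero_of_gcd_eq_zero_left hd.symm
      subst hM1
      simp at h1 h2
      omega
    · rfl
  · rw [Nat.mod_eq_of_lt (by omega : 1 < d)] at h1d
    exact absurd h1d (by norm_num)

/-- **The Chinese-remainder walk with a validated unit.** Same enumeration as `loopCRTe`; the unit is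
`e = M₁·u`, `u = invCand M₁ M₂`, used only if it passes the check `e % M₂ = 1 % M₂` (which also certifies
that the two moduli are coprime); otherwise the plain double iteration `loopBest`.  The residue of the
derived member modulo `M₁M₂` is formed as `M₁·(u·s mod M₂)` (`= e·s mod M₁M₂`, one product of numbers
below `M₂`). [folklore] -/
def loopCRTv (N A B C : ℕ) (test : ℕ → ℕ → ℕ → Bool) : Bool :=
  if A ≤ C ∧ B ≤ C then
    -- iterate `c = C·k`; `a ≡ 0 (A)`, `a ≡ c (B)`; `0 < a ≤ c - 1`
    let L := A * B
    let u := invCand A B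
    if (A * u) % B = 1 % B then
      allRange (fun k => allPosRes (A * (u * (C * k % B) % B)) L (C * k - 1)
        (fun a => test a (C * k - a) (C * k))) 1 (N / C) true
    else loopBest N A B C test
  else if B ≤ A ∧ C ≤ A then
    -- iterate `a = A·i`; `b ≡ 0 (B)`, `b ≡ -a (C)`; `0 < b ≤ N - a`
    let L := B * C
    let u := invCand B C
    if (B * u) % C = 1 % C then
      allRange (fun i => allPosRes (B * (u * ((C - A * i % C) % C) % C)) L (N - A * i)
        (fun b => test (A * i) b (A * i + b))) 1 (N / A) true
    else loopBest N A B C test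
  else
    -- iterate `b = B·j`; `a ≡ 0 (A)`, `a ≡ -b (C)`; `0 < a ≤ N - b`
    let L := A * C
    let u := invCand A C
    if (A * u) % C = 1 % C then
      allRange (fun j => allPosRes (A * (u * ((C - B * j % C) % C) % C)) L (N - B * j)
        (fun a => test a (B * j) (a + B * j))) 1 (N / B) true
    else loopBest N A B C test

/-- `loopCRTv` visits every solution. [folklore] -/
theorem loopCRTv_sound {N A B C : ℕ} {test : ℕ → ℕ → ℕ → Bool} (hA : 0 < A) (hB : 0 < B)
    (hC : 0 < C) (h : loopCRTv N A B C test = true) {a b c : ℕ} (ha : A ∣ a) (hb : B ∣ b)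
    (hc : C ∣ c) (ha0 : 0 < a) (hb0 : 0 < b) (habc : a + b = c) (hcN : c ≤ N) :
    test a b c = true := by
  unfold loopCRTv at h
  by_cases h₁ : A ≤ C ∧ B ≤ C
  · -- iterate `c`
    rw [if_pos h₁] at h
    dsimp only at h
    by_cases hchk : A * invCand A B % B = 1 % B
    · rw [if_pos hchk] at h
      have hAB : Nat.Coprime A B := coprime_of_unit_check (Nat.mul_mod_right A (invCand A B)) hchk
      obtain ⟨k, rfl⟩ := hc
      rw [allRange_eq_true_iff] at h
      have hk : 1 ≤ k := Nat.pos_of_ne_zero (by rintro rfl; simp at habc; omega)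
      have hkN : k < 1 + N / C := by
        have : k ≤ N / C := (Nat.le_div_iff_mul_le hC).mpr (by nlinarith)
        omega
      have hin := h.2 k hk hkN
      have he1 : A * invCand A B ≡ 0 [MOD A] := by
        unfold Nat.ModEq; rw [Nat.mul_mod_right, Nat.zero_mod]
      have he2 : A * invCand A B ≡ 1 [MOD B] := hchk
      have hres : a % (A * B) = A * (invCand A B * (C * k % B) % B) := by
        rw [← Nat.mul_mod_mul_left, ← Nat.mul_assoc]
        refine mod_mul_eq_unit_mul hAB he1 he2 ha ?_
        -- `a ≡ c (mod B)` since `B ∣ b = c - a`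
        obtain ⟨j, rfl⟩ := hb
        have hck : C * k = a + B * j := habc.symm
        have : a % B = C * k % B := by rw [hck, Nat.add_mul_mod_self_left]
        show a % B = C * k % B % B
        rw [Nat.mod_mod]; exact this
      have hf := allPosRes_spec (Nat.mul_pos hA hB) hin hres ha0 (by omega)
      have hb' : b = C * k - a := by omega
      subst hb'
      simpa using hf
    · rw [if_neg hchk] at h
      exact loopBest_sound hA hB hC h ha hb hc ha0 hb0 habc hcN
  · rw [if_neg h₁] at h
    by_cases h₂ : B ≤ A ∧ C ≤ A
    · -- iterate `a`
      rw [if_pos h₂] at h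
      dsimp only at h
      by_cases hchk : B * invCand B C % C = 1 % C
      · rw [if_pos hchk] at h
        have hBC : Nat.Coprime B C := coprime_of_unit_check (Nat.mul_mod_right B (invCand B C)) hchk
        obtain ⟨i, rfl⟩ := ha
        rw [allRange_eq_true_iff] at h
        have hi : 1 ≤ i := Nat.pos_of_ne_zero (by rintro rfl; simp at ha0)
        have hiN : i < 1 + N / A := by
          have : i ≤ N / A := (Nat.le_div_iff_mul_le hA).mpr (by nlinarith)
          omega
        have hin := h.2 i hi hiN
        have he1 : B * invCand B C ≡ 0 [MOD B] := by
          unfold Nat.ModEq; rw [Nat.mul_mod_right, Nat.zero_mod]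
        have he2 : B * invCand B C ≡ 1 [MOD C] := hchk
        have hres : b % (B * C) = B * (invCand B C * ((C - A * i % C) % C) % C) := by
          rw [← Nat.mul_mod_mul_left, ← Nat.mul_assoc]
          refine mod_mul_eq_unit_mul hBC he1 he2 hb ?_
          have : b % C = (C - A * i % C) % C := mod_eq_neg_mod hC (habc ▸ hc)
          show b % C = (C - A * i % C) % C % C
          rw [Nat.mod_mod]; exact this
        have hf := allPosRes_spec (Nat.mul_pos hB hC) hin hres hb0 (by omega)
        subst habc
        simpa using hf
      · rw [if_neg hchk] at h
        exact loopBest_sound hA hB hC h ha hb hc ha0 hb0 habc hcN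
    · -- iterate `b`
      rw [if_neg h₂] at h
      dsimp only at h
      by_cases hchk : A * invCand A C % C = 1 % C
      · rw [if_pos hchk] at h
        have hAC : Nat.Coprime A C := coprime_of_unit_check (Nat.mul_mod_right A (invCand A C)) hchk
        obtain ⟨j, rfl⟩ := hb
        rw [allRange_eq_true_iff] at h
        have hj : 1 ≤ j := Nat.pos_of_ne_zero (by rintro rfl; simp at hb0)
        have hjN : j < 1 + N / B := by
          have : j ≤ N / B := (Nat.le_div_iff_mul_le hB).mpr (by nlinarith)
          omega
        have hin := h.2 j hj hjN
        have he1 : A * invCand A C ≡ 0 [MOD A] := by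
          unfold Nat.ModEq; rw [Nat.mul_mod_right, Nat.zero_mod]
        have he2 : A * invCand A C ≡ 1 [MOD C] := hchk
        have hres : a % (A * C) = A * (invCand A C * ((C - B * j % C) % C) % C) := by
          rw [← Nat.mul_mod_mul_left, ← Nat.mul_assoc]
          refine mod_mul_eq_unit_mul hAC he1 he2 ha ?_
          have : a % C = (C - B * j % C) % C :=
            mod_eq_neg_mod hC (by rw [add_comm]; exact habc ▸ hc)
          show a % C = (C - B * j % C) % C % C
          rw [Nat.mod_mod]; exact this
        have hf := allPosRes_spec (Nat.mul_pos hA hC) hin hres ha0 (by omega)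
        subst habc
        simpa using hf
      · rw [if_neg hchk] at h
        exact loopBest_sound hA hB hC h ha hb hc ha0 hb0 habc hcN

/-- **The per-pattern walk of the turbo checker**: the plain double iteration `loopBest` when the
lattice is sparse (`(N / M_max)·(N / M_mid) ≤ 24`, about a dozen candidates), else the Chinese-remainder
walk `loopCRTv`. [folklore] -/
def loopTurbo (N A B C : ℕ) (test : ℕ → ℕ → ℕ → Bool) : Bool :=
  let mx := max A (max B C)
  let mn := min A (min B C)
  let md := A + B + C - mx - mn
  if (N / mx) * (N / md) ≤ 24 then loopBest N A B C test else loopCRTv N A B C test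

/-- `loopTurbo` visits every solution. [folklore] -/
theorem loopTurbo_sound {N A B C : ℕ} {test : ℕ → ℕ → ℕ → Bool} (hA : 0 < A) (hB : 0 < B)
    (hC : 0 < C) (h : loopTurbo N A B C test = true) {a b c : ℕ} (ha : A ∣ a) (hb : B ∣ b)
    (hc : C ∣ c) (ha0 : 0 < a) (hb0 : 0 < b) (habc : a + b = c) (hcN : c ≤ N) :
    test a b c = true := by
  unfold loopTurbo at h
  dsimp only at h
  split_ifs at h
  · exact loopBest_sound hA hB hC h ha hb hc ha0 hb0 habc hcN
  · exact loopCRTv_sound hA hB hC h ha hb hc ha0 hb0 habc hcN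

/-! ## Empty sub-trees: the min-member cut -/

/-- **The min-member cut.** If `N < min(A,B,C)·q⁵` for every available prime `q`, no further prime fits
into any member: the sub-tree with `k + 1` primes still to place holds no pattern. [folklore] -/
theorem patterns_succ_eq_nil (N : ℕ) : ∀ (ps : List ℕ) (k A B C : ℕ),
    (∀ q ∈ ps, N < min A (min B C) * q ^ 5) → patterns N ps (k + 1) A B C = [] := by
  intro ps
  induction ps with
  | nil => intro k A B C _; rfl
  | cons p ps ih =>
    intro k A B C hmin
    have hp : N < min A (min B C) * p ^ 5 := hmin p (by simp)
    have hps : ∀ q ∈ ps, N < min A (min B C) * q ^ 5 := fun q hq => hmin q (by simp [hq])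
    have hA : ¬ A * p ^ 5 ≤ N := fun h =>
      absurd (lt_of_lt_of_le hp (Nat.mul_le_mul_right _ (min_le_left _ _))) (not_lt.mpr h)
    have hB : ¬ B * p ^ 5 ≤ N := fun h =>
      absurd (lt_of_lt_of_le hp (Nat.mul_le_mul_right _
        ((min_le_right _ _).trans (min_le_left _ _)))) (not_lt.mpr h)
    have hC : ¬ C * p ^ 5 ≤ N := fun h =>
      absurd (lt_of_lt_of_le hp (Nat.mul_le_mul_right _
        ((min_le_right _ _).trans (min_le_right _ _)))) (not_lt.mpr h)
    simp only [patterns]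
    split_ifs
    · rfl
    · rw [ih k A B C hps]; rfl

/-- The cut at a node: with an ascending prime list headed by `p` and `N < min(A,B,C)·p⁵`, the node's
pattern list is empty. [folklore] -/
theorem patterns_cons_succ_eq_nil {N p : ℕ} {ps : List ℕ} {k A B C : ℕ}
    (hsort : (p :: ps).Pairwise (· ≤ ·)) (hmin : N < min A (min B C) * p ^ 5) :
    patterns N (p :: ps) (k + 1) A B C = [] := by
  refine patterns_succ_eq_nil N (p :: ps) k A B C (fun q hq => lt_of_lt_of_le hmin ?_)
  refine Nat.mul_le_mul_left _ (Nat.pow_le_pow_left ?_ 5)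
  rcases List.mem_cons.mp hq with rfl | hq'
  · exact le_rfl
  · exact List.rel_of_pairwise_cons hsort hq'

/-! ## The threshold table -/

/-- Per-prime table of the turbo walk: `(p, p⁵, #[⌊N³/4⌋, ⌊N³/(4p⁵)⌋, …, ⌊N³/(4p^{5K})⌋])` for the primes of
`deepPrimes N R`. [folklore] -/
def turboTable (N R K : ℕ) : List (ℕ × ℕ × Array ℕ) :=
  (deepPrimes N R).map fun p => (p, p ^ 5, (Array.range (K + 1)).map fun j => N ^ 3 / (4 * p ^ (5 * j)))

/-- Well-formedness of a table against `N`, `K`: second components are fifth powers, thresholds are the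
quotients `⌊N³ / (4p^{5j})⌋` for `j ≤ K`. [folklore] -/
def TableOK (N K : ℕ) (tbl : List (ℕ × ℕ × Array ℕ)) : Prop :=
  ∀ e ∈ tbl, e.2.1 = e.1 ^ 5 ∧ ∀ j, j ≤ K → e.2.2.getD j 0 = N ^ 3 / (4 * e.1 ^ (5 * j))

/-- Lookup in a tabulated function. [folklore] -/
theorem getD_range_map (f : ℕ → ℕ) {n j : ℕ} (hj : j < n) :
    ((Array.range n).map f).getD j 0 = f j := by
  simp [Array.getD, hj]

/-- `turboTable` is well formed. [folklore] -/
theorem turboTable_ok (N R K : ℕ) : TableOK N K (turboTable N R K) := by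
  intro e he
  simp only [turboTable, List.mem_map] at he
  obtain ⟨p, -, rfl⟩ := he
  exact ⟨rfl, fun j hj => getD_range_map _ (Nat.lt_succ_of_le hj)⟩

/-- The primes of `turboTable` are `deepPrimes`. [folklore] -/
theorem turboTable_map_fst (N R K : ℕ) : (turboTable N R K).map Prod.fst = deepPrimes N R := by
  simp [turboTable, List.map_map, Function.comp_def]

/-- A tail of a well-formed table is well formed. [folklore] -/
theorem TableOK.tail {N K : ℕ} {e : ℕ × ℕ × Array ℕ} {tbl : List (ℕ × ℕ × Array ℕ)}
    (h : TableOK N K (e :: tbl)) : TableOK N K tbl :=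
  fun x hx => h x (List.mem_cons_of_mem _ hx)

/-! ## The fused walk -/

/-- **The fused depth-first walk of the pattern tree** (`M = A·B·C` carried along): at a leaf run `loop`;
at a node prune by the threshold table (`⌊N³/(4p^{5(k+1)})⌋ < M`, i.e. `N³ < 4·A·B·C·p^{5(k+1)}`) and
by the min-member cut (`N < min(A,B,C)·p⁵`), else conjoin the four children. [folklore] -/
def turboTree (N : ℕ) (loop : ℕ → ℕ → ℕ → Bool) :
    List (ℕ × ℕ × Array ℕ) → ℕ → ℕ → ℕ → ℕ → ℕ → Bool
  | _, 0, A, B, C, _ => loop A B C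
  | [], _ + 1, _, _, _, _ => true
  | (_, p5, T) :: ps, k + 1, A, B, C, M =>
      if T.getD (k + 1) 0 < M then true
      else if N < min A (min B C) * p5 then true
      else
        turboTree N loop ps (k + 1) A B C M &&
        (if A * p5 ≤ N then turboTree N loop ps k (A * p5) B C (M * p5) else true) &&
        (if B * p5 ≤ N then turboTree N loop ps k A (B * p5) C (M * p5) else true) &&
        (if C * p5 ≤ N then turboTree N loop ps k A B (C * p5) (M * p5) else true)

/-- The table prune is the product bound of `patterns`. [folklore] -/
theorem prune_iff {N p k A B C M : ℕ} {T : Array ℕ} (hT : T.getD (k + 1) 0 = N ^ 3 / (4 * p ^ (5 * (k + 1))))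
    (hp : 0 < p) (hM : M = A * B * C) :
    T.getD (k + 1) 0 < M ↔ N ^ 3 < 4 * (A * B * C) * p ^ (5 * (k + 1)) := by
  rw [hT, Nat.div_lt_iff_lt_mul (by positivity), hM]
  constructor <;> intro h <;> nlinarith [h]

/-- **Soundness of the fused walk**: on a well-formed, ascending table with positive primes, acceptance
means that `loop` accepts every pattern of `patterns`. [folklore] -/
theorem turboTree_sound (N K : ℕ) (loop : ℕ → ℕ → ℕ → Bool) :
    ∀ (tbl : List (ℕ × ℕ × Array ℕ)) (k A B C M : ℕ), TableOK N K tbl →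
      (tbl.map Prod.fst).Pairwise (· ≤ ·) → (∀ e ∈ tbl, 0 < e.1) → k ≤ K → M = A * B * C →
      turboTree N loop tbl k A B C M = true →
      ∀ x ∈ patterns N (tbl.map Prod.fst) k A B C, loop x.1 x.2.1 x.2.2 = true := by
  intro tbl
  induction tbl with
  | nil =>
    intro k A B C M _ _ _ _ _ h x hx
    cases k with
    | zero =>
      simp only [patterns, List.mem_singleton] at hx
      subst hx
      simpa [turboTree] using h
    | succ k => simp [patterns] at hx
  | cons e tbl ih =>
    intro k A B C M hok hsort hpos hk hM h x hx
    obtain ⟨p, p5, T⟩ := e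
    cases k with
    | zero =>
      simp only [patterns, List.mem_singleton] at hx
      subst hx
      simpa [turboTree] using h
    | succ k =>
      have hsort' : (tbl.map Prod.fst).Pairwise (· ≤ ·) := by
        simp only [List.map_cons] at hsort; exact hsort.of_cons
      have hpos' : ∀ e ∈ tbl, 0 < e.1 := fun e he => hpos e (List.mem_cons_of_mem _ he)
      have hp : 0 < p := hpos (p, p5, T) (by simp)
      obtain ⟨hp5, hT⟩ := hok (p, p5, T) (by simp)
      simp only at hp5 hT
      have hT' := hT (k + 1) hk
      simp only [turboTree] at h
      simp only [List.map_cons] at hx hsort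
      by_cases hpr : T.getD (k + 1) 0 < M
      · -- product-bound prune: the node has no pattern
        have hpr' : N ^ 3 < 4 * (A * B * C) * p ^ (5 * (k + 1)) := (prune_iff hT' hp hM).mp hpr
        simp [patterns, hpr'] at hx
      · rw [if_neg hpr] at h
        by_cases hmin : N < min A (min B C) * p5
        · -- min-member cut: the node has no pattern
          rw [hp5] at hmin
          rw [patterns_cons_succ_eq_nil hsort hmin] at hx
          simp at hx
        · rw [if_neg hmin] at h
          simp only [Bool.and_eq_true] at h
          obtain ⟨⟨⟨h0, h1⟩, h2⟩, h3⟩ := h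
          have hpr' : ¬ N ^ 3 < 4 * (A * B * C) * p ^ (5 * (k + 1)) :=
            fun h' => hpr ((prune_iff hT' hp hM).mpr h')
          simp only [patterns, if_neg hpr', List.mem_append] at hx
          have hk' : k ≤ K := Nat.le_of_succ_le hk
          rcases hx with hx | hx | hx | hx
          · exact ih (k + 1) A B C M hok.tail hsort' hpos' hk hM h0 x hx
          · by_cases hle : A * p ^ 5 ≤ N
            · rw [if_pos hle] at hx
              rw [hp5, if_pos hle] at h1
              exact ih k (A * p ^ 5) B C (M * p ^ 5) hok.tail hsort' hpos' hk'
                (by rw [hM]; ring) h1 x hx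
            · simp [hle] at hx
          · by_cases hle : B * p ^ 5 ≤ N
            · rw [if_pos hle] at hx
              rw [hp5, if_pos hle] at h2
              exact ih k A (B * p ^ 5) C (M * p ^ 5) hok.tail hsort' hpos' hk'
                (by rw [hM]; ring) h2 x hx
            · simp [hle] at hx
          · by_cases hle : C * p ^ 5 ≤ N
            · rw [if_pos hle] at hx
              rw [hp5, if_pos hle] at h3
              exact ih k A B (C * p ^ 5) (M * p ^ 5) hok.tail hsort' hpos' hk'
                (by rw [hM]; ring) h3 x hx
            · simp [hle] at hx

/-- **The fused walk below a chunk prefix** (`0` = skip, `1/2/3` = to `a/b/c`), replaying the two prunes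
of `turboTree` along the way exactly as `followPrefix` replays those of `patterns`. [folklore] -/
def turboFollow (N : ℕ) (loop : ℕ → ℕ → ℕ → Bool) :
    List (Fin 4) → List (ℕ × ℕ × Array ℕ) → ℕ → ℕ → ℕ → ℕ → ℕ → Bool
  | [], ps, k, A, B, C, M => turboTree N loop ps k A B C M
  | δ :: π, ps, 0, A, B, C, M => if δ = 0 then turboFollow N loop π ps 0 A B C M else true
  | _ :: _, [], _ + 1, _, _, _, _ => true
  | δ :: π, (_, p5, T) :: ps, k + 1, A, B, C, M =>
      if T.getD (k + 1) 0 < M then true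
      else if N < min A (min B C) * p5 then true
      else if δ = 0 then turboFollow N loop π ps (k + 1) A B C M
      else if δ = 1 then (if A * p5 ≤ N then turboFollow N loop π ps k (A * p5) B C (M * p5) else true)
      else if δ = 2 then (if B * p5 ≤ N then turboFollow N loop π ps k A (B * p5) C (M * p5) else true)
      else (if C * p5 ≤ N then turboFollow N loop π ps k A B (C * p5) (M * p5) else true)

/-- **Soundness of the prefix walk**: acceptance means that `loop` accepts every pattern of the chunk
`followPrefix`. [folklore] -/
theorem turboFollow_sound (N K : ℕ) (loop : ℕ → ℕ → ℕ → Bool) :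
    ∀ (π : List (Fin 4)) (tbl : List (ℕ × ℕ × Array ℕ)) (k A B C M : ℕ), TableOK N K tbl →
      (tbl.map Prod.fst).Pairwise (· ≤ ·) → (∀ e ∈ tbl, 0 < e.1) → k ≤ K → M = A * B * C →
      turboFollow N loop π tbl k A B C M = true →
      ∀ x ∈ followPrefix N π (tbl.map Prod.fst) k A B C, loop x.1 x.2.1 x.2.2 = true := by
  intro π
  induction π with
  | nil =>
    intro tbl k A B C M hok hsort hpos hk hM h x hx
    have hx' : x ∈ patterns N (tbl.map Prod.fst) k A B C := by
      simpa [followPrefix, mem_patternsAcc] using hx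
    exact turboTree_sound N K loop tbl k A B C M hok hsort hpos hk hM h x hx'
  | cons δ π ih =>
    intro tbl k A B C M hok hsort hpos hk hM h x hx
    cases k with
    | zero =>
      simp only [followPrefix] at hx
      simp only [turboFollow] at h
      by_cases h0 : δ = 0
      · rw [if_pos h0] at hx h
        exact ih tbl 0 A B C M hok hsort hpos hk hM h x hx
      · simp [h0] at hx
    | succ k =>
      cases tbl with
      | nil => simp [followPrefix] at hx
      | cons e tbl =>
        obtain ⟨p, p5, T⟩ := e
        have hsort' : (tbl.map Prod.fst).Pairwise (· ≤ ·) := by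
          simp only [List.map_cons] at hsort; exact hsort.of_cons
        have hpos' : ∀ e ∈ tbl, 0 < e.1 := fun e he => hpos e (List.mem_cons_of_mem _ he)
        have hp : 0 < p := hpos (p, p5, T) (by simp)
        obtain ⟨hp5, hT⟩ := hok (p, p5, T) (by simp)
        simp only at hp5 hT
        have hT' := hT (k + 1) hk
        have hk' : k ≤ K := Nat.le_of_succ_le hk
        simp only [turboFollow] at h
        simp only [List.map_cons] at hx hsort
        -- `x` is in particular a pattern of the node
        have hxpat : x ∈ patterns N (p :: tbl.map Prod.fst) (k + 1) A B C :=
          followPrefix_subset N x (δ :: π) _ _ _ _ _ hx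
        by_cases hpr : T.getD (k + 1) 0 < M
        · have hpr' : N ^ 3 < 4 * (A * B * C) * p ^ (5 * (k + 1)) := (prune_iff hT' hp hM).mp hpr
          simp [patterns, hpr'] at hxpat
        · rw [if_neg hpr] at h
          by_cases hmin : N < min A (min B C) * p5
          · rw [hp5] at hmin
            rw [patterns_cons_succ_eq_nil hsort hmin] at hxpat
            simp at hxpat
          · rw [if_neg hmin] at h
            have hpr' : ¬ N ^ 3 < 4 * (A * B * C) * p ^ (5 * (k + 1)) :=
              fun h' => hpr ((prune_iff hT' hp hM).mpr h')
            simp only [followPrefix, if_neg hpr'] at hx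
            by_cases h0 : δ = 0
            · rw [if_pos h0] at hx h
              exact ih tbl (k + 1) A B C M hok.tail hsort' hpos' hk hM h x hx
            · rw [if_neg h0] at hx h
              by_cases h1 : δ = 1
              · rw [if_pos h1] at hx h
                by_cases hle : A * p ^ 5 ≤ N
                · rw [if_pos hle] at hx
                  rw [hp5, if_pos hle] at h
                  exact ih tbl k (A * p ^ 5) B C (M * p ^ 5) hok.tail hsort' hpos' hk'
                    (by rw [hM]; ring) h x hx
                · simp [hle] at hx
              · rw [if_neg h1] at hx h
                by_cases h2 : δ = 2
                · rw [if_pos h2] at hx h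
                  by_cases hle : B * p ^ 5 ≤ N
                  · rw [if_pos hle] at hx
                    rw [hp5, if_pos hle] at h
                    exact ih tbl k A (B * p ^ 5) C (M * p ^ 5) hok.tail hsort' hpos' hk'
                      (by rw [hM]; ring) h x hx
                  · simp [hle] at hx
                · rw [if_neg h2] at hx h
                  by_cases hle : C * p ^ 5 ≤ N
                  · rw [if_pos hle] at hx
                    rw [hp5, if_pos hle] at h
                    exact ih tbl k A B (C * p ^ 5) (M * p ^ 5) hok.tail hsort' hpos' hk'
                      (by rw [hM]; ring) h x hx
                  · simp [hle] at hx

/-! ## The turbo chunk checker -/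

/-- **One chunk of the turbo cell check**: the fused walk below the prefix `π` with the dispatching
per-pattern walk `loopTurbo`. [folklore] -/
def checkTurboChunk (N R K : ℕ) (π : List (Fin 4)) (test : ℕ → ℕ → ℕ → Bool) : Bool :=
  turboFollow N (fun A B C => loopTurbo N A B C test) π (turboTable N R K) K 1 1 1 1

/-- **Soundness of the turbo chunked check.** If `N < (R+1)⁵`, `S` covers some depth `d`, and every
chunk named in `S` is accepted, then `test` holds on every abc triple with `c ≤ N` and `ω₅(abc) ≥ K`.
[folklore] -/
theorem checkTurboChunks_sound {N R K : ℕ} {test : ℕ → ℕ → ℕ → Bool} (hR : N < (R + 1) ^ 5)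
    {S : List (List (Fin 4))} {d : ℕ} (hS : coversAll S d = true)
    (h : ∀ s ∈ S, checkTurboChunk N R K s test = true) {a b c : ℕ} (habc : IsABCTriple a b c)
    (hcN : c ≤ N)
    (hK : K ≤ ((a * b * c).primeFactors.filter (fun p => 5 ≤ (a * b * c).factorization p)).card) :
    test a b c = true := by
  refine sound_of_forall_patterns (loop := fun N A B C test => loopTurbo N A B C test)
    (fun hA hB hC hl _ _ _ ha hb hc ha0 hb0 hs hN => loopTurbo_sound hA hB hC hl ha hb hc ha0 hb0 hs hN)
    hR (fun t ht => ?_) habc hcN hK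
  obtain ⟨s, hs, hts⟩ := exists_mem_followPrefix_of_coversAll hS ht
  have hrun := h s hs
  rw [← turboTable_map_fst N R K] at hts
  exact turboFollow_sound N K (fun A B C => loopTurbo N A B C test) s (turboTable N R K) K 1 1 1 1
    (turboTable_ok N R K) (by rw [turboTable_map_fst]; exact deepPrimes_sorted N R)
    (fun e he => by
      simp only [turboTable, List.mem_map] at he
      obtain ⟨p, hp, rfl⟩ := he
      exact (mem_deepPrimes.mp hp).2.1.pos)
    le_rfl (by ring) hrun t hts

/-- **Empty cells (turbo).** [folklore] -/
theorem depth_lt_of_checkTurboChunks {N R K : ℕ} (hR : N < (R + 1) ^ 5) {S : List (List (Fin 4))}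
    {d : ℕ} (hS : coversAll S d = true)
    (h : ∀ s ∈ S, checkTurboChunk N R K s (fun _ _ _ => false) = true) {a b c : ℕ}
    (habc : IsABCTriple a b c) (hcN : c ≤ N) :
    ((a * b * c).primeFactors.filter (fun p => 5 ≤ (a * b * c).factorization p)).card < K := by
  by_contra hK
  exact Bool.false_ne_true (checkTurboChunks_sound hR hS h habc hcN (not_lt.mp hK))

/-- **No abc triple in the cell-in-the-box (turbo)**, from the test "`gcd(a,b) ≠ 1`". [folklore] -/
theorem depth_lt_of_checkTurboChunks_gcd {N R K : ℕ} (hR : N < (R + 1) ^ 5) {S : List (List (Fin 4))}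
    {d : ℕ} (hS : coversAll S d = true)
    (h : ∀ s ∈ S, checkTurboChunk N R K s (fun a b _ => !(Nat.gcd a b == 1)) = true) {a b c : ℕ}
    (habc : IsABCTriple a b c) (hcN : c ≤ N) :
    ((a * b * c).primeFactors.filter (fun p => 5 ≤ (a * b * c).factorization p)).card < K := by
  by_contra hK
  have hrun := checkTurboChunks_sound hR hS h habc hcN (not_lt.mp hK)
  have hcop : Nat.gcd a b = 1 := habc.2.2.2
  simp [hcop] at hrun

/-- **Census (turbo).** If every chunk of a cover accepts `hitTest L`, every abc hit of the cell
`{ω₅ ≥ K}` in the box `{c ≤ N}` is listed in `L` with its radical, in one of the two orientations.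
[folklore] -/
theorem hits_complete_of_checkTurboChunks {N R K : ℕ} {L : List (ℕ × ℕ × ℕ × ℕ)}
    (hR : N < (R + 1) ^ 5) {S : List (List (Fin 4))} {d : ℕ} (hS : coversAll S d = true)
    (h : ∀ s ∈ S, checkTurboChunk N R K s (hitTest L) = true) {a b c : ℕ}
    (habc : IsABCTriple a b c) (hcN : c ≤ N)
    (hK : K ≤ ((a * b * c).primeFactors.filter (fun p => 5 ≤ (a * b * c).factorization p)).card)
    (hlt : rad a b c < c) : (a, b, c, rad a b c) ∈ L ∨ (b, a, c, rad a b c) ∈ L :=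
  hitTest_sound habc (checkTurboChunks_sound hR hS h habc hcN hK) hlt

/-- **Members (turbo).** With the member test — "`gcd(a,b) ≠ 1`, or `(a,b,c)` is listed in one of the
two orientations" — every abc triple of the cell `{ω₅ ≥ K}` in the box `{c ≤ N}` is listed. [folklore] -/
theorem members_complete_of_checkTurboChunks {N R K : ℕ} {Lm : List (ℕ × ℕ × ℕ)}
    (hR : N < (R + 1) ^ 5) {S : List (List (Fin 4))} {d : ℕ} (hS : coversAll S d = true)
    (h : ∀ s ∈ S, checkTurboChunk N R K s
      (fun a b c => !(Nat.gcd a b == 1) || (Lm.elem (a, b, c) || Lm.elem (b, a, c))) = true)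
    {a b c : ℕ} (habc : IsABCTriple a b c) (hcN : c ≤ N)
    (hK : K ≤ ((a * b * c).primeFactors.filter (fun p => 5 ≤ (a * b * c).factorization p)).card) :
    (a, b, c) ∈ Lm ∨ (b, a, c) ∈ Lm := by
  have hrun := checkTurboChunks_sound hR hS h habc hcN hK
  have hcop : Nat.gcd a b = 1 := habc.2.2.2
  simp only [hcop, beq_self_eq_true, Bool.not_true, Bool.false_or, Bool.or_eq_true] at hrun
  rcases hrun with h1 | h1
  · exact Or.inl (List.mem_of_elem_eq_true h1)
  · exact Or.inr (List.mem_of_elem_eq_true h1)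

end Literature.NumberTheory.DiophantineGeometry.DepthCensus
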